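import Summits.QuantumFields.YangMills.Theorems.UnitScaleTiltFluctuationComparisonRegPrDualWhitney3DGauge

/-!
# Route `UnitScaleTilt` — crux K1bR-pr `FluctuationComparisonRegPr` (stmt-QuantumFields-19201), stub `stub_oneStepSmallLift`
# (W7 line), piece (L1) FOR EVERY ODD BLOCK SIZE: the GAUGE-BLIND, S-NEUTRAL form `Z = R₁ − d₀K − faceSec` of the dual Whitney lift
# (support file `--supports stmt-QuantumFields-19201`; sequel of `…DualWhitney3DGauge`; cell `ym3-torus`, seat `ym3-torus-p1` gen 10; memo UV3-NODE §19.2)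

PROVED here: `Qmean_K` (`Q∘K = 0`: the block means of the gauge potential vanish — transverse duality), `R1_d0` (`R₁∘d₀ = d₀∘R₀`:
the lift of a pure coarse gauge is a pure fine gauge — step identity), and for `Lam v := R₁v − d₀(Kv)`, `Zop v := Lam v − faceSec v`:
`Lam_d0`/`Zop_d0` (GAUGE-BLINDNESS `Z(d₀g) = 0`), `Sline_Lam`/`Sline_Zop` (`S(Λ′v) = v` EXACTLY, `S(Zv) = 0`: S-NEUTRALITY), `d1_Lam`
(`d₁(Λ′v) = R₂(d₁v)`, curvature unchanged).  So `u = faceSec v + Zv` is the certified shape «face section + S-neutral correction» of the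
cell's (L1) certificates, for EVERY odd `L`, with `Z` annihilating coarse gauges — the form in which block-local axial-gauge logarithms of a
lattice field can be fed to it consistently (UV3-NODE §19.2).  Elementary finite sums; nothing of Bałaban's is asserted.
-/

noncomputable section


namespace Summit.QuantumFields.YangMills.Theorems.DualWhitney

open Finset

variable {E : Type*} [NormedAddCommGroup E] [NormedSpace ℝ E]
variable (h : ℕ)

/-! ## §16 `Q ∘ K = 0` -/

/-- The block of a point `Ly − h + i` of the block `y` is `y`. -/
theorem blk_apt_zero (y : Site) (μ : Fin 3) {i : Fin 3 → ℕ} (hi : i ∈ box h) : blk h (apt h y μ i 0) = y := by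
  have hL : (0 : ℤ) < bL h := by rw [bL_int]; omega
  funext a
  have hia : i a < bL h := by
    unfold box at hi; rw [Fintype.mem_piFinset] at hi; exact mem_range.mp (hi a)
  unfold blk apt
  have e : (bL h : ℤ) * y a - h + (i a : ℕ) + (if a = μ then ((0 : ℕ) : ℤ) else 0) + h = (i a : ℤ) + y a * (bL h : ℤ) := by
    split_ifs <;> push_cast <;> ring
  rw [e, Int.add_mul_ediv_right _ _ hL.ne', Int.ediv_eq_zero_of_lt (by omega) (by exact_mod_cast hia), zero_add]

/-- The 0-form weights along the block `y` see only `y`: `Σ_{i∈[0,L)³} wt0(Ly − h + i, y′) = L³·[y′ = y]`. -/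
theorem sum_wt0_apt (y y' : Site) : ∑ i ∈ box h, wt0 h (apt h y 0 i 0) y' = if y' = y then (bL h : ℝ) ^ 3 else 0 := by
  set g : Fin 3 → ℕ → ℝ := fun a k => phi0 h ((bL h : ℤ) * (y a - y' a) - h + k) with hg
  have step1 : ∀ i ∈ box h, wt0 h (apt h y 0 i 0) y' = ∏ a, g a (i a) := by
    intro i _
    unfold wt0 apt
    refine prod_congr rfl fun a _ => ?_
    simp only [hg]
    congr 1; split_ifs <;> push_cast <;> ring
  rw [sum_congr rfl step1]
  have step2 : ∑ i ∈ box h, ∏ a, g a (i a) = ∏ a, ∑ k ∈ range (bL h), g a k := by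
    unfold box; rw [prod_univ_sum]
  rw [step2]
  have step3 : ∀ a, ∑ k ∈ range (bL h), g a k = if y a - y' a = 0 then (bL h : ℝ) else 0 := by
    intro a; simp only [hg]; rw [← sum_phi0_eq h (y a - y' a)]
  simp_rw [step3]
  by_cases hy : y' = y
  · subst hy; simp
  · rw [if_neg hy]
    have : ∃ a, y a - y' a ≠ 0 := by
      by_contra hcon
      push Not at hcon
      exact hy (funext fun a => by linarith [hcon a])
    obtain ⟨a, ha⟩ := this
    exact prod_eq_zero (mem_univ a) (by simp [ha])

/-- **`Q ∘ K = 0`**: the block means of the gauge potential vanish (transverse duality of `Φ₀`), so the correction `d₀(Kv)` is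
invisible to the line average. -/
theorem Qmean_K (v : Site → Fin 3 → E) (y : Site) : Qmean h (K h v) y = 0 := by
  unfold Qmean
  have hK : ∀ i ∈ box h, K h v (apt h y 0 i 0)
      = ∑ y' ∈ winY y, (wt0 h (apt h y 0 i 0) y' - if y' = y then 1 else 0) • pathsum v y (y' - y) := by
    intro i hi
    unfold K
    have hb := blk_apt_zero h y 0 hi
    have hw : win h (apt h y 0 i 0) = winY y := by unfold win winY; rw [hb]
    rw [hw, hb]
  rw [sum_congr rfl hK, sum_comm]
  simp_rw [← sum_smul, sum_sub_distrib, sum_wt0_apt]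
  have : ∀ y' ∈ winY y, ((if y' = y then (bL h : ℝ) ^ 3 else 0) - ∑ _i ∈ box h, if y' = y then (1 : ℝ) else 0)
      • pathsum v y (y' - y) = 0 := by
    intro y' _
    rw [sum_const]
    unfold box
    rw [Fintype.card_piFinset, prod_const, card_range, card_univ, Fintype.card_fin]
    split_ifs <;> simp
  rw [sum_congr rfl this, sum_const_zero, smul_zero]


/-! ## §17 `R₁ ∘ d₀ = d₀ ∘ R₀` -/

/-- A sum of `wt0`-weighted terms over any superset of the radius-1 box equals the sum over the box. -/
theorem sum_wt0_subset {z : Site} {W : Finset Site} (hW : supp1 h z ⊆ W) (g : Site → E) :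
    ∑ y ∈ W, wt0 h z y • g y = ∑ y ∈ supp1 h z, wt0 h z y • g y := by
  symm
  exact sum_subset hW fun y _ hy => by rw [wt0_eq_zero h hy, zero_smul]

/-- `R₀` at `x + e_a` as a sum over the window at `x`. -/
theorem R0_add_unit_eq (g : Site → E) (x : Site) (a : Fin 3) :
    R0 h g (x + unit a) = ∑ y ∈ win h x, wt0 h (x + unit a) y • g y := by
  unfold R0
  rw [sum_wt0_subset h (supp1_subset_win h (x + unit a)), ← sum_wt0_subset h (supp1_add_unit_subset_win h x a)]

/-- **STEP IDENTITY, 0-FORM VERSION**: shifting the fine site by `e_a` changes the 0-form weight by `−L⁻¹ ×` a difference of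
`R₁`-weights in direction `a` at `y` and `y − e_a` (`h ≥ 1`). -/
theorem wt0_sub_shift (hh : 1 ≤ h) (x y : Site) (a : Fin 3) :
    wt0 h (x + unit a) y - wt0 h x y = -(((bL h : ℝ))⁻¹ * (wt1 h a x y - wt1 h a x (y - unit a))) := by
  have hL := bL_pos h
  set Q : ℝ := ∏ b, if b = a then (1 : ℝ) else phi0 h (x b - bL h * y b) with hQ
  have s1 : wt0 h x y = phi0 h (x a - bL h * y a) * Q := by
    unfold wt0; rw [hQ, ← prod_ite_split]
    refine prod_congr rfl fun b _ => ?_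
    by_cases hb : b = a
    · subst hb; simp
    · simp [hb]
  have s2 : wt0 h (x + unit a) y = phi0 h (x a - bL h * y a + 1) * Q := by
    unfold wt0; rw [hQ, ← prod_ite_split]
    refine prod_congr rfl fun b _ => ?_
    by_cases hb : b = a
    · subst hb; simp [unit_apply]; ring_nf
    · simp [unit_apply, hb]
  have s3 : wt1 h a x y = phi1 h (x a - bL h * y a) * Q := by
    unfold wt1; rw [hQ, ← prod_ite_split]
    refine prod_congr rfl fun b _ => ?_
    by_cases hb : b = a
    · subst hb; simp
    · simp [hb]
  have s4 : wt1 h a x (y - unit a) = phi1 h (x a - bL h * y a + bL h) * Q := by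
    unfold wt1; rw [hQ, ← prod_ite_split]
    refine prod_congr rfl fun b _ => ?_
    by_cases hb : b = a
    · subst hb; simp [unit_apply]; ring_nf
    · simp [unit_apply, hb]
  rw [s1, s2, s3, s4, ← sub_mul, ← sub_mul]
  have step := phi0_step h hh (x a - bL h * y a)
  have : phi0 h (x a - ↑(bL h) * y a + 1) - phi0 h (x a - ↑(bL h) * y a)
      = -(((bL h : ℝ))⁻¹ * (phi1 h (x a - ↑(bL h) * y a) - phi1 h (x a - ↑(bL h) * y a + ↑(bL h)))) := by
    rw [← step]; field_simp; ring
  rw [this]; ring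

/-- Re-indexing of `wt1`-weighted block sums by a unit vector (the weights vanish off the radius-1 box, the window has radius 2). -/
theorem sum_win_shift1 (μ : Fin 3) (z : Site) (a : Fin 3) (g : Site → E) :
    ∑ y ∈ win h z, wt1 h μ z (y - unit a) • g y = ∑ y ∈ win h z, wt1 h μ z y • g (y + unit a) := by
  set F : Site → E := fun w => wt1 h μ z w • g (w + unit a) with hF
  have hF0 : ∀ w, w ∉ supp1 h z → F w = 0 := fun w hw => by simp only [hF]; rw [wt1_eq_zero h μ hw, zero_smul]
  have hsub : supp1 h z ⊆ (win h z).image (fun y => y - unit a) := by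
    intro w hw
    exact mem_image.mpr ⟨w + unit a, add_unit_mem_win h hw a, by simp⟩
  calc ∑ y ∈ win h z, wt1 h μ z (y - unit a) • g y
      = ∑ y ∈ win h z, F (y - unit a) := sum_congr rfl fun y _ => by simp only [hF, sub_add_cancel]
    _ = ∑ w ∈ (win h z).image (fun y => y - unit a), F w :=
        (sum_image fun x _ y _ hxy => by simpa using hxy).symm
    _ = ∑ w ∈ supp1 h z, F w := (sum_subset hsub fun w _ hw => hF0 w hw).symm
    _ = ∑ w ∈ win h z, F w := sum_subset (supp1_subset_win h z) fun w _ hw => hF0 w hw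

/-- **`R₁ ∘ d₀ = d₀ ∘ R₀`**: the dual Whitney lift of a coarse pure gauge is the fine gradient of the 0-form interpolant (`h ≥ 1`). -/
theorem R1_d0 (hh : 1 ≤ h) (g : Site → E) (x : Site) (a : Fin 3) : R1 h (d0 g) x a = d0 (R0 h g) x a := by
  have A : ∑ y ∈ win h x, (wt0 h (x + unit a) y - wt0 h x y) • g y
      = -(((bL h : ℝ))⁻¹ • (∑ y ∈ win h x, wt1 h a x y • g y - ∑ y ∈ win h x, wt1 h a x (y - unit a) • g y)) := by
    simp_rw [wt0_sub_shift h hh, neg_smul, sum_neg_distrib, mul_smul, ← smul_sum, sub_smul, sum_sub_distrib]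
  unfold d0 R1
  rw [R0_add_unit_eq]
  unfold R0
  rw [← sum_sub_distrib]
  simp_rw [← sub_smul]
  rw [A, sum_win_shift1, ← sum_sub_distrib]
  simp_rw [← smul_sub]
  rw [← smul_neg, ← sum_neg_distrib]
  simp_rw [← smul_neg, neg_sub]


/-! ## §18 `Λ′ = R₁ − d₀K` and `Z = Λ′ − faceSec`: gauge-blind, S-neutral, same curvature -/

/-- THE GAUGE-CORRECTED LIFT `(Λ′v)(x;a) = (R₁v)(x;a) − (d₀Kv)(x;a)`. -/
def Lam (v : Site → Fin 3 → E) (x : Site) (a : Fin 3) : E := R1 h v x a - d0 (K h v) x a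

/-- THE S-NEUTRAL CORRECTION `Z v = Λ′v − faceSec v` (so that the lift is `faceSec v + Z v`, the certified shape). -/
def Zop (v : Site → Fin 3 → E) (x : Site) (a : Fin 3) : E := Lam h v x a - faceSec h v x a

omit [NormedSpace ℝ E] in
/-- `d₀` is additive under pointwise subtraction of 0-cochains. -/
theorem d0_sub (f f' : Site → E) (x : Site) (a : Fin 3) :
    d0 (fun z => f z - f' z) x a = d0 f x a - d0 f' x a := by
  unfold d0; exact sub_sub_sub_comm _ _ _ _

omit [NormedSpace ℝ E] in
/-- `d₁` of a pointwise difference. -/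
theorem d1_sub (w w' : Site → Fin 3 → E) (z : Site) (μ ν : Fin 3) :
    d1 (fun x a => w x a - w' x a) z μ ν = d1 w z μ ν - d1 w' z μ ν := by
  simp only [d1]; abel

/-- The line average of a pointwise difference. -/
theorem Sline_sub (w w' : Site → Fin 3 → E) (y : Site) (μ : Fin 3) :
    Sline h (fun x a => w x a - w' x a) y μ = Sline h w y μ - Sline h w' y μ := by
  unfold Sline; rw [← smul_sub, ← sum_sub_distrib]; congr 1
  exact sum_congr rfl fun i _ => sum_sub_distrib _ _

/-- **GAUGE-BLINDNESS**: on a coarse pure gauge the corrected lift IS the face section, `Λ′(d₀g) = faceSec(d₀g)` (`h ≥ 1`). -/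
theorem Lam_d0 (hh : 1 ≤ h) (g : Site → E) (x : Site) (a : Fin 3) : Lam h (d0 g) x a = faceSec h (d0 g) x a := by
  unfold Lam
  have hK : K h (d0 g) = fun z => R0 h g z - Eext h g z := funext fun z => K_d0 h g z
  rw [R1_d0 h hh, hK, d0_sub, d0_Eext]; abel

/-- **`Z ∘ d₀ = 0`**: the correction annihilates coarse pure gauges — so `Z` may be fed block-local axial-gauge logarithms (`h ≥ 1`). -/
theorem Zop_d0 (hh : 1 ≤ h) (g : Site → E) (x : Site) (a : Fin 3) : Zop h (d0 g) x a = 0 := by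
  unfold Zop; rw [Lam_d0 h hh, sub_self]

/-- **`S ∘ Λ′ = 1`**: the gauge correction is invisible to the line average (`Q∘K = 0`), so `Λ′v` still averages to `v` EXACTLY (`h ≥ 1`). -/
theorem Sline_Lam (hh : 1 ≤ h) (v : Site → Fin 3 → E) (y : Site) (μ : Fin 3) : Sline h (Lam h v) y μ = v y μ := by
  have : Lam h v = fun x a => R1 h v x a - d0 (K h v) x a := rfl
  rw [this, Sline_sub, Sline_R1 h hh, Sline_d0]
  unfold d0; rw [Qmean_K, Qmean_K, sub_zero, sub_zero]

/-- **S-NEUTRALITY `S ∘ Z = 0`**: the correction `Z v` has vanishing line average, exactly. -/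
theorem Sline_Zop (hh : 1 ≤ h) (v : Site → Fin 3 → E) (y : Site) (μ : Fin 3) : Sline h (Zop h v) y μ = 0 := by
  have : Zop h v = fun x a => Lam h v x a - faceSec h v x a := rfl
  rw [this, Sline_sub, Sline_Lam h hh, Sline_faceSec, sub_self]

/-- **CURVATURE UNCHANGED**: `d₁(Λ′v) = R₂(d₁v)` (`d₁∘d₀ = 0`; `h ≥ 1`). -/
theorem d1_Lam (hh : 1 ≤ h) (v : Site → Fin 3 → E) (z : Site) (μ ν : Fin 3) : d1 (Lam h v) z μ ν = R2 h (d1 v) z μ ν := by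
  have : Lam h v = fun x a => R1 h v x a - d0 (K h v) x a := rfl
  rw [this, d1_sub, d1_R1 h hh, d1_d0, sub_zero]

/-- **THE CERTIFIED SHAPE FOR EVERY ODD `L`**: the lift `faceSec v + Z v` has line average `v` exactly, fine curvature `R₂(d₁v)`
(hence `≤ 8L⁴/(L²+1)³·sup‖d₁v‖` plaquette-wise by `norm_R2_le'`), and `Z` is gauge-blind and S-neutral (`h ≥ 1`). -/
theorem faceSec_add_Zop (hh : 1 ≤ h) (v : Site → Fin 3 → E) :
    (∀ y μ, Sline h (fun x a => faceSec h v x a + Zop h v x a) y μ = v y μ) ∧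
    (∀ z, ∀ μ ν : Fin 3, d1 (fun x a => faceSec h v x a + Zop h v x a) z μ ν = R2 h (d1 v) z μ ν) ∧
    (∀ y μ, Sline h (Zop h v) y μ = 0) ∧ (∀ (g : Site → E) x a, Zop h (d0 g) x a = 0) := by
  have e : (fun x a => faceSec h v x a + Zop h v x a) = Lam h v := by
    funext x a; unfold Zop; abel
  rw [e]
  exact ⟨fun y μ => Sline_Lam h hh v y μ, fun z μ ν => d1_Lam h hh v z μ ν, fun y μ => Sline_Zop h hh v y μ,
    fun g x a => Zop_d0 h hh g x a⟩

end Summit.QuantumFields.YangMills.Theorems.DualWhitney
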